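import Summits.Ventures.PercRepro.RankLevelSetRuleQSliceThreeChain

/-!
# PercRepro — THE SECOND UNTRUNCATED SLICE `u = k` ON THE BOTTOM REGIME `m ≥ 3`, EVERY FAMILY `k ≥ 5` (night-1, gen 21; dossier §32.3)

The criterion `slice_bottom_of_three_le_one` at `u = k` (the density condition `m·k ≤ m·k + k² + k` is automatic):
* **`sliceTail_kk_three_le_one (k) (5 ≤ k) : sliceTail k k 3 ≤ 1`** — for `k ≥ 13` by the chain with the bracket `≤ 27/8`
  (`27(k+1)(k+2)(k+3)(2k+7) ≤ 16(2k+1)(2k+3)(k²+5k+7)`, i.e. `10k⁴ − 65k³ − 592k² − 1267k − 798 =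
  (k−13)(10k³+65k²+253k+2022) + 25488 ≥ 0`), for `5 ≤ k ≤ 12` by the exact evaluation of the `k + 1` terms
  (`T_k(3) = 0.889, 0.874, 0.863, 0.856, 0.851, 0.847, 0.844, 0.842`);
* **`second_untrunc_bottom (k m) (5 ≤ k) (3 ≤ m) (m ≤ k·k) : Φ(q+k, q) ≤ R̂(q, k, m)`** (`q = m + k`);
* **`second_untrunc_slice (k q) (5 ≤ k) (k + 3 ≤ q) (q ≤ k·k + k) : Φ(q+k, q) ≤ R̂(q, k, q − k)`** — the slice `u = k` is paid on
  every cell `k + 3 ≤ q ≤ k² + k` of every family `k ≥ 5` (the cells `q = k, k + 1` by `rhat_zero_eq`, `rhatCell_one`;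
  `q = k + 2`, `m = 2`, is open here: `T_k(2) ≈ 1.06 … 1.08` needs the ρ-slack, p4 covers it for `k ≤ 29`).
Twin: mining/night-1/g21/threechain.py, seconduntr2.py. Axioms: standard.
-/

namespace PercRepro

open Finset

/-- **`T_k(3) ≤ 1` for `k ≥ 13`** by the chain: the bracket is at most `27/8` (each `x_b = (k+b)/(2k+3+b) ≤ 1/2`), and
`27(k+1)(k+2)(k+3)(2k+7) ≤ 16(2k+1)(2k+3)(k²+5k+7)`. -/
lemma sliceTail_kk_three_le_one_of_large (k : ℕ) (hk : 13 ≤ k) : sliceTail k k 3 ≤ 1 := by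
  have hk' : (13 : ℚ) ≤ k := by exact_mod_cast hk
  have hP : threeRatio k k < 1 := by
    unfold threeRatio
    rw [div_lt_one (by positivity)]
    nlinarith
  have h := sliceTail_three_le_chain k k hP
  rw [sliceThreeTerm_zero_eq] at h
  -- the bracket ≤ 27/8
  have x1 : ((k : ℚ) + 1) / ((k : ℚ) + k + 4) ≤ 1 / 2 := by rw [div_le_div_iff₀ (by positivity) (by norm_num)]; linarith
  have x2 : ((k : ℚ) + 2) / ((k : ℚ) + k + 5) ≤ 1 / 2 := by rw [div_le_div_iff₀ (by positivity) (by norm_num)]; linarith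
  have x3 : ((k : ℚ) + 3) / ((k : ℚ) + k + 6) ≤ 1 / 2 := by rw [div_le_div_iff₀ (by positivity) (by norm_num)]; linarith
  have x10 : 0 ≤ ((k : ℚ) + 1) / ((k : ℚ) + k + 4) := by positivity
  have x20 : 0 ≤ ((k : ℚ) + 2) / ((k : ℚ) + k + 5) := by positivity
  have x30 : 0 ≤ ((k : ℚ) + 3) / ((k : ℚ) + k + 6) := by positivity
  have hbr : 1 + 3 * (((k : ℚ) + 1) / ((k : ℚ) + k + 4)) + 3 * (((k : ℚ) + 1) / ((k : ℚ) + k + 4)) * (((k : ℚ) + 2) / ((k : ℚ) + k + 5))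
      + (((k : ℚ) + 1) / ((k : ℚ) + k + 4)) * (((k : ℚ) + 2) / ((k : ℚ) + k + 5)) * (((k : ℚ) + 3) / ((k : ℚ) + k + 6)) ≤ 27 / 8 := by
    have h12 : ((k : ℚ) + 1) / ((k : ℚ) + k + 4) * (((k : ℚ) + 2) / ((k : ℚ) + k + 5)) ≤ (1 / 2) * (1 / 2) :=
      mul_le_mul x1 x2 x20 (by norm_num)
    have h123 : ((k : ℚ) + 1) / ((k : ℚ) + k + 4) * (((k : ℚ) + 2) / ((k : ℚ) + k + 5)) * (((k : ℚ) + 3) / ((k : ℚ) + k + 6))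
        ≤ (1 / 2) * (1 / 2) * (1 / 2) := mul_le_mul h12 x3 x30 (by norm_num)
    nlinarith
  -- 1/(1 − P₀) = (k+1)(2k+7)/(k²+5k+7)
  have hinv : 1 / (1 - threeRatio k k) = (((k : ℚ) + 1) * ((k : ℚ) + k + 7)) / ((k : ℚ) ^ 2 + 5 * k + 7) := by
    have h1 : 1 - threeRatio k k = ((k : ℚ) ^ 2 + 5 * k + 7) / (((k : ℚ) + 1) * ((k : ℚ) + k + 7)) := by
      unfold threeRatio
      rw [eq_div_iff (by positivity), sub_mul, div_mul_cancel₀ _ (by positivity)]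
      ring
    rw [h1, one_div_div]
  rw [hinv] at h
  have hR0 : 0 ≤ (((k : ℚ) + 1) * ((k : ℚ) + 2) * ((k : ℚ) + 3)) / (((k : ℚ) + k + 1) * ((k : ℚ) + k + 2) * ((k : ℚ) + k + 3)) := by
    positivity
  have hinv0 : 0 ≤ (((k : ℚ) + 1) * ((k : ℚ) + k + 7)) / ((k : ℚ) ^ 2 + 5 * k + 7) := by positivity
  have hfinal : (((k : ℚ) + 1) * ((k : ℚ) + 2) * ((k : ℚ) + 3)) / (((k : ℚ) + k + 1) * ((k : ℚ) + k + 2) * ((k : ℚ) + k + 3))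
      * (27 / 8) * ((((k : ℚ) + 1) * ((k : ℚ) + k + 7)) / ((k : ℚ) ^ 2 + 5 * k + 7)) ≤ 1 := by
    rw [div_mul_eq_mul_div, div_mul_div_comm, div_le_one (by positivity)]
    have hpoly : (0 : ℚ) ≤ ((k : ℚ) - 13) * (10 * (k : ℚ) ^ 3 + 65 * (k : ℚ) ^ 2 + 253 * k + 2022) := by
      apply mul_nonneg (by linarith) (by positivity)
    nlinarith [hpoly]
  calc sliceTail k k 3
      ≤ (((k : ℚ) + 1) * ((k : ℚ) + 2) * ((k : ℚ) + 3)) / (((k : ℚ) + k + 1) * ((k : ℚ) + k + 2) * ((k : ℚ) + k + 3))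
          * (1 + 3 * (((k : ℚ) + 1) / ((k : ℚ) + k + 4)) + 3 * (((k : ℚ) + 1) / ((k : ℚ) + k + 4)) * (((k : ℚ) + 2) / ((k : ℚ) + k + 5))
            + (((k : ℚ) + 1) / ((k : ℚ) + k + 4)) * (((k : ℚ) + 2) / ((k : ℚ) + k + 5)) * (((k : ℚ) + 3) / ((k : ℚ) + k + 6)))
          * ((((k : ℚ) + 1) * ((k : ℚ) + k + 7)) / ((k : ℚ) ^ 2 + 5 * k + 7)) := h
    _ ≤ (((k : ℚ) + 1) * ((k : ℚ) + 2) * ((k : ℚ) + 3)) / (((k : ℚ) + k + 1) * ((k : ℚ) + k + 2) * ((k : ℚ) + k + 3))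
          * (27 / 8) * ((((k : ℚ) + 1) * ((k : ℚ) + k + 7)) / ((k : ℚ) ^ 2 + 5 * k + 7)) := by
        apply mul_le_mul_of_nonneg_right _ hinv0
        exact mul_le_mul_of_nonneg_left hbr hR0
    _ ≤ 1 := hfinal

/-- **`T_k(3) ≤ 1` for `5 ≤ k ≤ 12`** by exact evaluation. -/
lemma sliceTail_kk_three_le_one_of_small (k : ℕ) (h5 : 5 ≤ k) (h12 : k ≤ 12) : sliceTail k k 3 ≤ 1 := by
  rw [sliceTail_three_eq]
  interval_cases k <;>
    (simp only [Finset.sum_range_succ, Finset.sum_range_zero, sliceThreeTerm, Nat.choose_eq_descFactorial_div_factorial]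
     norm_num [Nat.descFactorial, Nat.factorial])

/-- **`T_k(3) ≤ 1` for every `k ≥ 5`.** -/
theorem sliceTail_kk_three_le_one (k : ℕ) (hk : 5 ≤ k) : sliceTail k k 3 ≤ 1 := by
  rcases Nat.lt_or_ge k 13 with h | h
  · exact sliceTail_kk_three_le_one_of_small k hk (by omega)
  · exact sliceTail_kk_three_le_one_of_large k h

/-- **THE SECOND UNTRUNCATED SLICE ON THE BOTTOM REGIME `m ≥ 3`, EVERY FAMILY `k ≥ 5`**: `3 ≤ m ≤ k²` ⇒ `Φ(q+k, q) ≤ R̂(q, k, m)`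
(`u = k`, `q = m + k`). -/
theorem second_untrunc_bottom (k m : ℕ) (hk : 5 ≤ k) (h3 : 3 ≤ m) (hm : m ≤ k * k) :
    phiK (m + k + k) (m + k) ≤ rhat (m + k) k m :=
  slice_bottom_of_three_le_one k k m (by omega) (by nlinarith) h3 (by nlinarith) (sliceTail_kk_three_le_one k hk)

/-- **The slice `u = k` in the cell spelling**: `5 ≤ k`, `k + 3 ≤ q ≤ k² + k` ⇒ `Φ(q+k, q) ≤ R̂(q, k, q − k)`. -/
theorem second_untrunc_slice (k q : ℕ) (hk : 5 ≤ k) (hq : k + 3 ≤ q) (hq' : q ≤ k * k + k) :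
    phiK (q + k) q ≤ rhat q k (q - k) := by
  obtain ⟨m, rfl⟩ : ∃ m, q = m + k := ⟨q - k, by omega⟩
  rw [show m + k - k = m by omega]
  exact second_untrunc_bottom k m hk (by omega) (by omega)

end PercRepro
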